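import Summits.AtomisticToContinuum.HydrodynamicLimit.Theorems.RelayRaceLocalityConeLocalisationBubbleHypDefs
import Summits.AtomisticToContinuum.HydrodynamicLimit.Theorems.ImplosionDichotomyHsEosLowDensity
import Literature.Analysis.FluidPDE.CompressibleEulerHomogeneousEnergyStep
import Literature.Analysis.FluidPDE.CompressibleEulerCoefficientShape
import Literature.MathematicalPhysics.KineticTheory.HardSphereEulerUniformCoefficients
import Literature.MathematicalPhysics.KineticTheory.HardSphereEulerUniformCoefficientsB
import Literature.MathematicalPhysics.KineticTheory.HardSphereEulerLocalTheoryReduction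
import Literature.Analysis.FluidPDE.CompressibleEulerPrimitiveForm
import Literature.MathematicalPhysics.KineticTheory.HardSphereEulerSolutionGluing
import HarnessLib

/-!
# RelayRaceLocality · ConeLocalisation — bubble stub: the homogeneous energy input `EnergyHyp` discharged (File C)

Lead-held stub `stub_bubble : BubbleAtScale` of line `Sketch`, crux `stmt-AtomisticToContinuum-12504`; lead
prover-line-stmt-AtomisticToContinuum-12504-0 (2026-08-17). The typed input `Bubble.EnergyHyp` of the bubble assembly
(`…BubbleHypDefs.lean`) — the HOMOGENEOUS derivative-only level-`3` energy inequality with σ-uniform constants for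
classical hard-sphere Euler solutions near a constant state — is assembled from the Literature files landed for it:
the generic homogeneous Grönwall step `CompressibleEuler.derivLevelEnergy_three_le_of_le_one`
(`CompressibleEulerHomogeneousEnergyStep.lean`, p134962) with the coefficient bounds as INPUTS, the coefficient
structure `CompressibleEuler.coeff_bound_of_mem` (`CompressibleEulerCoefficientShape.lean`, p134769), and the σ-uniform
bounds for the family `ζ_σ(r) = Z(rσ³)` (`HardSphereEulerUniformCoefficients*.lean`); the solution is moved to the
primitive form by `isHardSphereEulerSolution_iff_isClassicalEulerSolution` + `primitive_monatomicExcess`, and the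
word-indexed `derivLevelEnergy … 3` is re-indexed into the nested-sum `D3` (`derivLevelEnergy_three_eq_D3`).
-/

noncomputable section

namespace Summit.AtomisticToContinuum.HydrodynamicLimit.Theorems.ConeLocalisation.Bubble

open Set MeasureTheory
open scoped ContDiff
open Literature.MathematicalPhysics.KineticTheory Literature.Analysis.FluidPDE
  Literature.Analysis.FunctionSpaces
open Literature.Analysis.FluidPDE.CompressibleEuler
open Summit.AtomisticToContinuum.HydrodynamicLimit.Theorems

/-! ## Re-indexing the word energy -/

/-- Sum over words of length `1` as a sum over letters. [folklore] -/
theorem sum_words_one (F : List (Fin 3) → ℝ) :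
    ∑ w : Fin 1 → Fin 3, F (List.ofFn w) = ∑ l : Fin 3, F [l] := by
  refine Fintype.sum_equiv (Equiv.funUnique (Fin 1) (Fin 3)) _ _ fun w => ?_
  simp [List.ofFn_succ]

/-- Sum over words of length `n + 1` as an iterated sum (first letter, then the tail). [folklore] -/
theorem sum_words_succ (n : ℕ) (F : List (Fin 3) → ℝ) :
    ∑ w : Fin (n + 1) → Fin 3, F (List.ofFn w) = ∑ a : Fin 3, ∑ w : Fin n → Fin 3, F (a :: List.ofFn w) := by
  rw [← Fintype.sum_prod_type']
  refine (Fintype.sum_equiv (Fin.consEquiv fun _ : Fin (n + 1) => Fin 3) _ _ fun p => ?_).symm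
  simp [List.ofFn_succ, Fin.consEquiv, Fin.cons_zero, Fin.cons_succ]

/-- Sum over words of length `2` as a double sum. [folklore] -/
theorem sum_words_two (F : List (Fin 3) → ℝ) :
    ∑ w : Fin 2 → Fin 3, F (List.ofFn w) = ∑ i : Fin 3, ∑ l : Fin 3, F [i, l] := by
  rw [sum_words_succ]
  refine Finset.sum_congr rfl fun i _ => ?_
  exact sum_words_one (fun v => F (i :: v))

/-- Sum over words of length `3` as a triple sum. [folklore] -/
theorem sum_words_three (F : List (Fin 3) → ℝ) :
    ∑ w : Fin 3 → Fin 3, F (List.ofFn w) = ∑ j : Fin 3, ∑ i : Fin 3, ∑ l : Fin 3, F [j, i, l] := by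
  rw [sum_words_succ]
  refine Finset.sum_congr rfl fun j _ => ?_
  exact sum_words_two (fun v => F (j :: v))

/-- The velocity term of the word energy as the integral of a squared norm (smooth slice). [folklore] -/
theorem sum_integral_sq_coord_eq (v : T3 → V3) (hv : Torus.IsSmooth v) (w : List (Fin 3)) :
    (∑ k : Fin 3, ∫ y, Torus.iterPartialDeriv w (fun y => v y k) y ^ 2) = ∫ y, ‖Torus.iterPartialDeriv w v y‖ ^ 2 := by
  have hg : Torus.IsSmooth (Torus.iterPartialDeriv w v) := hv.iterPartialDeriv w
  have hcoord : ∀ k : Fin 3, (fun y => Torus.iterPartialDeriv w (fun y => v y k) y ^ 2) =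
      fun y => Torus.iterPartialDeriv w v y k ^ 2 := by
    intro k; funext y; rw [iterPartialDeriv_apply_coord hv w y k]
  have hint : ∀ k : Fin 3, Integrable (fun y => Torus.iterPartialDeriv w v y k ^ 2) := by
    intro k
    have hc : Continuous fun y => Torus.iterPartialDeriv w v y k ^ 2 :=
      ((EuclideanSpace.proj k).continuous.comp hg.continuous).pow 2
    exact hc.integrable_unitAddTorus
  simp_rw [hcoord]
  rw [← integral_finsetSum _ fun k _ => hint k]
  refine integral_congr_ae (Filter.Eventually.of_forall fun y => ?_)
  show (∑ i, (Torus.iterPartialDeriv w v y) i ^ 2) = ‖Torus.iterPartialDeriv w v y‖ ^ 2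
  rw [EuclideanSpace.real_norm_sq_eq]

/-- The word energy with the velocity term as a squared norm. [folklore] -/
theorem wordEnergy_eq_norm (ρ θ : ℝ → T3 → ℝ) (u : ℝ → T3 → V3) (w : List (Fin 3)) (t : ℝ)
    (hu : Torus.IsSmooth (u t)) :
    wordEnergy ρ u θ w t = (∫ y, Torus.iterPartialDeriv w (ρ t) y ^ 2) + (∫ y, ‖Torus.iterPartialDeriv w (u t) y‖ ^ 2) +
      ∫ y, Torus.iterPartialDeriv w (θ t) y ^ 2 := by
  unfold wordEnergy
  rw [sum_integral_sq_coord_eq (u t) hu w]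

/-- The word-indexed derivative energy at level `3` equals the nested-sum energy `D3` (smooth velocity slice). [folklore] -/
theorem derivLevelEnergy_three_eq_D3 (ρ θ : ℝ → T3 → ℝ) (u : ℝ → T3 → V3) (t : ℝ)
    (hu : Torus.IsSmooth (u t)) : derivLevelEnergy ρ u θ 3 t = D3 ρ u θ t := by
  unfold derivLevelEnergy D3 fieldD3 fieldD3V
  have hIcc : Finset.Icc 1 3 = {1, 2, 3} := by decide
  rw [hIcc, Finset.sum_insert (by decide), Finset.sum_insert (by decide), Finset.sum_singleton]
  rw [sum_words_one (fun v => wordEnergy ρ u θ v t), sum_words_two (fun v => wordEnergy ρ u θ v t),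
    sum_words_three (fun v => wordEnergy ρ u θ v t)]
  simp only [wordEnergy_eq_norm ρ θ u _ t hu, Torus.iterPartialDeriv_cons, Torus.iterPartialDeriv_nil,
    Finset.sum_add_distrib]
  ring

/-! ## The energy input -/

/-- **The homogeneous energy input of the bubble assembly holds** (Majda's `H³` energy method in homogeneous,
derivative-only form with constants uniform in the reduced diameter). [cite: Majda1984, Ch. 2 Thm 2.2] -/
theorem energyHyp_holds : EnergyHyp := by
  obtain ⟨η₀, hη₀, F, hFa, hEq, -, -, -⟩ := hsEosLowDensity_proof
  obtain ⟨Z, ηc, ηH, hZ, hZeq, -, hηc₀, hηH, hηHc, -, hPack⟩ :=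
    HsEulerUniform.exists_uniform_coefficient_bounds hη₀ hFa hEq
  refine ⟨ηH, hηH, fun M hM => ?_⟩
  obtain ⟨c₀, c₁, Λ, B, hc₀, hc₀₁, hΛ1, hΛM, hB1, hK⟩ := hPack M hM
  have hM0 : 0 < M := one_pos.trans_le hM
  have hG0 : 0 ≤ Λ * B := by
    have hΛ0 : 0 ≤ Λ := zero_le_one.trans hΛ1
    have hB0 : 0 ≤ B := zero_le_one.trans hB1
    positivity
  refine ⟨max 1 (c₁ / c₀ * Real.exp ((12 * Λ ^ 3 + 18 * (12 * Λ ^ 3) ^ 2 +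
    273780 * (12 * Λ ^ 3) * (Λ * B) * Λ ^ 4) / c₀)), le_max_left _ _, ?_⟩
  intro σ hσ ρbar θbar ubar hρb hρb' hθb hθb' hub hpack T hT hT1 ρ θ u hsol hbox t ht
  have hτ0 : 0 ≤ σ ^ 3 := by positivity
  have hτM : σ ^ 3 ∈ Icc 0 (M * ηH) := ⟨hτ0, HsEulerUniform.tau_le_of_box hM0 hρb hτ0 hpack⟩
  obtain ⟨hwK, hΛK, hBK⟩ := hK (σ ^ 3) hτM
  -- the state stays in the fibred state set `K_τ`
  have hstate : ∀ s ∈ Ico 0 T, ∀ x, (ρ s x, θ s x) ∈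
      (Icc (3 / (4 * M)) (5 * M / 4) ×ˢ Icc (3 / (4 * M)) (5 * M / 4)) ∩ {z : ℝ × ℝ | z.1 * σ ^ 3 ≤ ηc} :=
    fun s hs x => HsEulerUniform.mem_fibreSet_of_box hM hρb hρb' hθb hθb' (hbox s hs x).1 (hbox s hs x).2.1 hτ0
      hpack hηHc.le
  -- packing fractions inside the bridge's range
  have hρpack : ∀ s ∈ Ico 0 T, ∀ y, ρ s y * σ ^ 3 ∈ Icc 0 (η₀ / 2) := fun s hs y =>
    HsEulerUniform.packing_mem_of_mem_fibreSet hM0 hτ0 hηc₀ (hstate s hs y)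
  -- move to the primitive form of the classical system with the monatomic athermal law `ζ_σ(r) = Z(rσ³)`
  have hζ : ContDiff ℝ ∞ (fun s => Z (s * σ ^ 3)) := hZ.comp (contDiff_id.mul contDiff_const)
  have hcl : IsClassicalEulerSolution (EulerEOS.monatomicExcess (fun s => Z (s * σ ^ 3)) F) T ρ u θ :=
    (isHardSphereEulerSolution_iff_isClassicalEulerSolution F hZeq hρpack).1 hsol
  have hprim := hcl.primitive_monatomicExcess hζ
  -- first-order bounds `≤ Λ`
  have hC1 : ∀ s ∈ Ico 0 T, ∀ x, ‖u s x‖ ≤ Λ ∧ ∀ i, |Torus.partialDeriv i (ρ s) x| ≤ Λ ∧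
      ‖Torus.partialDeriv i (u s) x‖ ≤ Λ ∧ |Torus.partialDeriv i (θ s) x| ≤ Λ := by
    intro s hs x
    obtain ⟨-, -, hu, hd⟩ := hbox s hs x
    refine ⟨?_, fun i => ⟨(hd i).1.trans hΛ1, (hd i).2.1.trans hΛ1, (hd i).2.2.trans hΛ1⟩⟩
    have h14 : 1 / (4 * M) ≤ M / 4 := by
      rw [div_le_div_iff₀ (by positivity) (by norm_num)]; nlinarith
    calc ‖u s x‖ = ‖(u s x - ubar) + ubar‖ := by rw [sub_add_cancel]
      _ ≤ ‖u s x - ubar‖ + ‖ubar‖ := norm_add_le _ _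
      _ ≤ 1 / (4 * M) + M := add_le_add hu hub
      _ ≤ Λ := by linarith
  -- the homogeneous level-3 energy inequality
  have hmain := derivLevelEnergy_three_le_of_le_one hζ hc₀ hc₀₁ hΛ1 hG0 hwK hΛK
    (fun w hw => coeff_bound_of_mem hΛ1 hB1 (fun z hz => (hΛK z hz).2.1) w
      (fun z hz j hj => hBK z hz j (hj.trans (hw.trans (by norm_num)))))
    hT hT1 hprim hstate hC1 t ht
  have hu0 : Torus.IsSmooth (u 0) := hsol.smooth_velocity.isSmooth_slice ⟨le_rfl, hT⟩
  have hut : Torus.IsSmooth (u t) := hsol.smooth_velocity.isSmooth_slice ht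
  rw [derivLevelEnergy_three_eq_D3 ρ θ u t hut, derivLevelEnergy_three_eq_D3 ρ θ u 0 hu0] at hmain
  exact hmain.trans (mul_le_mul_of_nonneg_right (le_max_right _ _) (D3_nonneg ρ u θ 0))

end Summit.AtomisticToContinuum.HydrodynamicLimit.Theorems.ConeLocalisation.Bubble

end
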